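import Mathlib
import Literature.Probability.Percolation.Percolation
import Literature.Probability.LatticeModels.TriangularLattice
import Summits.CriticalPhenomena.CardyFormulaZ2.Theorems.CardyMagicRigidityHexSegmentDefs
import HarnessLib

/-!
# Stub `stub_coinMeasurable` (S3) of line `Sketch`, crux `LoopLimitZ2EqT` (stmt-CriticalPhenomena-4833)

Measurability of the two coin maps of the hex-segment model: the bond configuration `cfg S` of a
coin set `S` and the half-mesh refinement `refine ω` of a bond configuration `ω`. Both targets are
`Set _ = _ → Prop` with the product σ-algebra, so measurability is checked coordinatewise
(`measurable_set_iff`); every coordinate is a countable disjunction (over `Site 2`, `Fin 3`) of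
finite Boolean combinations of coordinate events `measurable_set_mem`.
-/

noncomputable section

open MeasureTheory Set

namespace Summit.CriticalPhenomena.CardyFormulaZ2.Cruxes.LoopLimitZ2EqT.HexSegment

open Literature.Probability.Percolation Literature.Probability.LatticeModels

/-- The coin-to-bond map `cfg` is measurable: the coordinate `e ∈ cfg S` is a countable disjunction
over `(x, k) : Site 2 × Fin 3` of a constant conjoined with Boolean combinations of three coin
coordinates. -/
theorem coinMeasurable_cfg : Measurable cfg := by
  refine measurable_set_iff.2 fun e ↦ ?_
  simp only [cfg, mem_setOf_eq]
  exact Measurable.exists fun x ↦ Measurable.exists fun k ↦ measurable_const.and <|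
    ((measurable_set_mem _).and (measurable_set_mem _)).or
      ((measurable_set_mem _).not.and (measurable_set_mem _))

/-- The half-mesh refinement `refine` is measurable: the coordinate `v ∈ refine ω` is a countable
disjunction over `(x, y) : Site 2 × Site 2` of constants conjoined with one bond coordinate. -/
theorem coinMeasurable_refine : Measurable refine := by
  refine measurable_set_iff.2 fun v ↦ ?_
  simp only [refine, mem_setOf_eq]
  exact Measurable.exists fun x ↦ Measurable.exists fun y ↦ measurable_const.and <|
    measurable_const.or (measurable_const.and (measurable_set_mem _))

/-- **S3 `CoinMeasurable`.** Both coin maps `cfg` and `refine` of the hex-segment model are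
measurable. -/
theorem stub_coinMeasurable : CoinMeasurable :=
  ⟨coinMeasurable_cfg, coinMeasurable_refine⟩

end Summit.CriticalPhenomena.CardyFormulaZ2.Cruxes.LoopLimitZ2EqT.HexSegment

end
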